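import Mathlib
import HarnessLib
import Summits.MatrixMultiplication.MatrixMultiplication.Theorems.OutsiderSandwichSliceGap
import Summits.MatrixMultiplication.MatrixMultiplication.Theorems.OutsiderSandwichKernelDichotomy
import Literature.LinearAlgebra.Matrix.RankInequalities
import Literature.Computability.AlgebraicComplexity.GroupAlgebraTensor
import Literature.Computability.AlgebraicComplexity.BorderRankCW
import Literature.Barriers.MatrixMultiplication.IrreversibilityBarrierProofs

/-!
# OutsiderSandwich — `⟨7⟩ ≰ cw₂^{⊠2}`: the subrank of the Kronecker square of `T_{cw,2}` is `6`
(decomp-mm lens 4 «minimal-counterexample / extremal reduction», gen 39, kernel K39-c; THESES-FREE,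
DEFINITION-FREE — summit-side imports: the pencil calculus Parts I/II/IIc and K39-a/b only)

`D` is ANY tensor with `hD : ∀ a b c, D a b c = if a ≠ b ∧ b ≠ c ∧ a ≠ c then 1 else 0` (`cw₂ ≅ D` over
`ℂ`, `diagPow_two_restrictsTo_cwPow_two`), `T₂(α) = contract3 (D^{⊠2}) α`.

* **Four product slices cannot share a kernel plane** (`false_of_ker_le_range`): independent
  `α_i = λ_i ⊗ μ_i` (`i ∈ ι`, `|ι| ≥ 4`) with singular factors (`D(λ_i) x̂_i = 0 = D(μ_i) ŷ_i`) admit no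
  plane `K` inside every `col T₂(α_i)`: two independent `x̂`'s and two independent `ŷ`'s annihilate `K`
  down to a line (`finrank_le_one_of_vanishing`: `P X Qᵀ` is supported on one entry), and proportional
  `x̂`'s (or `ŷ`'s) make the `λ_i` (resp. `μ_i`) proportional by rigidity, putting four independent `α_i`
  in a `3`-space.
* **Main theorem** (`not_unitTensor_seven_le_diagPow_two`): `⟨7⟩ ≰ D^{⊠2}`.  A restriction is
  `B T₂(α_i) Cᵀ = E_{ii}` (`i < 7`) with `A, B, C` of row rank `7` in `ℂ⁹` (K39-b); Sylvester's rank
  inequality gives `rank T₂(α_i) ≤ 5`, so by the slice gap (K39-a) every `α_i` is a product with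
  singular factors; the kernel dichotomy (K39-b, `rank T₂(α_i) ≥ 4 = 2 · (9 - 7)`) puts the plane
  `ker B` or `ker C` inside `col T₂(α_i)` for at least four of the seven `i` — contradiction.
* **Corollaries**: `⟨7⟩ ≰ cw₂^{⊠2}` (`not_unitTensor_seven_le_cwPow_two`) and `Q(cw₂^{⊠2}) ≤ 6`
  (`subrank_cwPow_two_le_six`).  With the tree's zeroing-out floor `⟨6⟩ ≤ cw₂^{⊠2}` this decides
  `Q(cw₂^{⊠2}) = 6`: the `N = 2` window `6 ≤ Q ≤ 7` of the packing census (floor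
  `OutsiderSandwichPackFloors.cwPow_two_restrictsTo_unitSix_complex` ‖ ceiling `2^N + 2Q ≤ 1 + 2·3^N` of
  `OutsiderSandwichPackingSlack.subrank_window`) closes at its FLOOR — the first exact value of
  `Q(cw₂^{⊠N})` beyond `N = 1`.

Bearing on the cut (`LaserTangency`, necessity direction): the diagonal packings `⟨B⟩ ≤ cw₂^{⊠N}`
are the `m = 1` corner of the sandwich `⟨B⟩ ⊠ ⟨m,m,m⟩ ≤ cw₂^{⊠N}`; at `N = 2` the corner value is now
exact (`B ≤ 6 < 7`, the pencil-law ceiling), a genuine (if small-`N`) deficit that the slice-gap /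
kernel-dichotomy mechanism produces and the pencil laws of Parts I–IIc cannot; the same mechanism
bounds `Q(cw₂^{⊠N}) ≤ 3^N - d` whenever `d < 3·2^{N-2}` forces the dichotomy (a hand computation
along the same lines suggests `≤ 21` at `N = 3`, `≤ 69` at `N = 4`; not formalised here), still
`(2/3)^N`-small against `3^N`.

References: [cite: CoppersmithWinograd1990, §6]; [cite: ChristandlVranaZuiddam2023, §1.1];
[cite: BurgisserClausenShokrollahi1997, Prop. 15.25]; [cite: HornJohnson2013, §0.4];
[cite: LandsbergGCT2017, §3.4.9].
-/

set_option linter.dupNamespace false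

noncomputable section

namespace Summit.MatrixMultiplication.MatrixMultiplication.Theorems.OutsiderSandwichSubrankSix

open Literature.Computability.AlgebraicComplexity
open Summit.MatrixMultiplication.MatrixMultiplication.Theorems.OutsiderSandwichPencilBlocks
open Summit.MatrixMultiplication.MatrixMultiplication.Theorems.OutsiderSandwichSliceGap
open Summit.MatrixMultiplication.MatrixMultiplication.Theorems.OutsiderSandwichKernelDichotomy
open scoped Matrix BigOperators

variable {D : Fin 3 → Fin 3 → Fin 3 → ℂ}

/-! ## §1  Four product slices cannot share a kernel plane -/

/-- **Two-sided annihilation leaves a line.**  If `x̂_a, x̂_b` are independent, `ŷ_c, ŷ_d` are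
independent, and every member `x` of a subspace `K ≤ ℂ^{3 × 3}` (indexed by words of length `2`) is
killed by `x̂_a, x̂_b` from the left and by `ŷ_c, ŷ_d` from the right, then `dim K ≤ 1`
(`P X Qᵀ` is supported on one entry for invertible `P, Q`). [cite: HornJohnson2013, §0.4] -/
theorem finrank_le_one_of_vanishing {xa xb yc yd : Fin 3 → ℂ}
    (hx : LinearIndependent ℂ ![xa, xb]) (hy : LinearIndependent ℂ ![yc, yd])
    (K : Submodule ℂ ((Fin 2 → Fin 3) → ℂ))
    (hK : ∀ x ∈ K, (∀ c', ∑ b, xa b * x ![b, c'] = 0) ∧ (∀ c', ∑ b, xb b * x ![b, c'] = 0) ∧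
      (∀ b', ∑ c, x ![b', c] * yc c = 0) ∧ (∀ b', ∑ c, x ![b', c] * yd c = 0)) :
    Module.finrank ℂ K ≤ 1 := by
  -- complete both pairs to bases of `ℂ³`
  obtain ⟨p, hp⟩ : ∃ p : Fin 3 → ℂ, p ∉ Submodule.span ℂ (Set.range ![xa, xb]) := by
    by_contra h
    push Not at h
    have htop := Submodule.eq_top_iff'.mpr h
    have h2 := finrank_span_eq_card hx
    rw [htop, finrank_top, Module.finrank_fintype_fun_eq_card] at h2
    simp at h2
  obtain ⟨q, hq⟩ : ∃ q : Fin 3 → ℂ, q ∉ Submodule.span ℂ (Set.range ![yc, yd]) := by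
    by_contra h
    push Not at h
    have htop := Submodule.eq_top_iff'.mpr h
    have h2 := finrank_span_eq_card hy
    rw [htop, finrank_top, Module.finrank_fintype_fun_eq_card] at h2
    simp at h2
  have hP : LinearIndependent ℂ ![p, xa, xb] := linearIndependent_finCons.mpr ⟨hx, hp⟩
  have hQ : LinearIndependent ℂ ![q, yc, yd] := linearIndependent_finCons.mpr ⟨hy, hq⟩
  have hPu : IsUnit (Matrix.of ![p, xa, xb]) := Matrix.linearIndependent_rows_iff_isUnit.mp hP
  have hQu : IsUnit (Matrix.of ![q, yc, yd]) := Matrix.linearIndependent_rows_iff_isUnit.mp hQ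
  have hQtu : IsUnit (Matrix.of ![q, yc, yd])ᵀ :=
    (Matrix.isUnit_iff_isUnit_det _).mpr
      (by rw [Matrix.det_transpose]; exact (Matrix.isUnit_iff_isUnit_det _).mp hQu)
  -- the linear functional `x ↦ (P X Qᵀ)₀₀`
  let φ : ((Fin 2 → Fin 3) → ℂ) →ₗ[ℂ] ℂ :=
    ∑ b : Fin 3, ∑ c : Fin 3, (p b * q c) •
      (LinearMap.proj ![b, c] : ((Fin 2 → Fin 3) → ℂ) →ₗ[ℂ] ℂ)
  have hφ : ∀ x, φ x = ∑ b, ∑ c, p b * q c * x ![b, c] := by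
    intro x
    simp [φ, LinearMap.sum_apply, LinearMap.smul_apply]
  have hinj : Function.Injective (φ ∘ₗ K.subtype) := by
    refine (injective_iff_map_eq_zero _).mpr ?_
    rintro ⟨x, hxK⟩ hx0
    obtain ⟨h1, h2, h3, h4⟩ := hK x hxK
    have hφx : ∑ b, ∑ c, p b * q c * x ![b, c] = 0 := by rw [← hφ]; exact hx0
    have hPXQ : Matrix.of ![p, xa, xb] * Matrix.of (fun b c => x ![b, c]) *
        (Matrix.of ![q, yc, yd])ᵀ = 0 := by
      ext k l
      simp only [Matrix.mul_apply, Matrix.transpose_apply, Matrix.of_apply, Matrix.zero_apply]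
      fin_cases k
      · fin_cases l
        · simp only [Finset.sum_mul]
          rw [Finset.sum_comm, ← hφx]
          refine Finset.sum_congr rfl fun b _ => Finset.sum_congr rfl fun c _ => ?_
          simp
          ring
        · simp only [Finset.sum_mul]
          rw [Finset.sum_comm]
          refine Finset.sum_eq_zero fun b _ => ?_
          have := h3 b
          simp only [Matrix.cons_val_zero, Matrix.cons_val_one, Fin.mk_one]
          calc ∑ c, p b * x ![b, c] * yc c = p b * ∑ c, x ![b, c] * yc c := by
                rw [Finset.mul_sum]; exact Finset.sum_congr rfl fun c _ => by ring
            _ = 0 := by rw [this, mul_zero]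
        · simp only [Finset.sum_mul]
          rw [Finset.sum_comm]
          refine Finset.sum_eq_zero fun b _ => ?_
          have := h4 b
          simp only [Matrix.cons_val_zero, Matrix.cons_val_two, Fin.reduceFinMk, Matrix.tail_cons,
            Matrix.head_cons]
          calc ∑ c, p b * x ![b, c] * yd c = p b * ∑ c, x ![b, c] * yd c := by
                rw [Finset.mul_sum]; exact Finset.sum_congr rfl fun c _ => by ring
            _ = 0 := by rw [this, mul_zero]
      · simp [h1]
      · simp [h2]
    have hX : Matrix.of (fun b c => x ![b, c]) = 0 := by
      have h0 : Matrix.of ![p, xa, xb] * Matrix.of (fun b c => x ![b, c]) * (Matrix.of ![q, yc, yd])ᵀ =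
          Matrix.of ![p, xa, xb] * 0 * (Matrix.of ![q, yc, yd])ᵀ := by
        rw [hPXQ, Matrix.mul_zero, Matrix.zero_mul]
      exact (IsUnit.mul_right_inj hPu).mp ((IsUnit.mul_left_inj hQtu).mp h0)
    apply Subtype.ext
    funext f
    have hf : ![f 0, f 1] = f := by funext j; fin_cases j <;> rfl
    have := congr_fun (congr_fun hX (f 0)) (f 1)
    simp only [Matrix.of_apply, Matrix.zero_apply] at this
    rw [hf] at this
    exact this
  have := LinearMap.finrank_le_finrank_of_injective hinj
  simpa using this

/-- **Four product slices cannot share a kernel plane.**  Let `α_i = λ_i ⊗ μ_i` (`i ∈ ι`, `|ι| ≥ 4`)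
be linearly independent covectors on words of length `2` with `D(λ_i) x̂_i = 0`, `D(μ_i) ŷ_i = 0`
(`x̂_i, ŷ_i ≠ 0`), and let `K` be a subspace of dimension `≥ 2` inside every column space
`col T₂(α_i)`.  Contradiction: two independent `x̂`'s and two independent `ŷ`'s leave `dim K ≤ 1`
(`finrank_le_one_of_vanishing`); otherwise all `x̂_i` (or all `ŷ_i`) are proportional, rigidity makes
all `λ_i` (resp. `μ_i`) proportional, and the `α_i` lie in a `3`-space. [cite: CoppersmithWinograd1990, §6] -/
theorem false_of_ker_le_range (hD : ∀ a b c, D a b c = if a ≠ b ∧ b ≠ c ∧ a ≠ c then 1 else 0)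
    {ι : Type*} [Fintype ι] (hι : 4 ≤ Fintype.card ι) {α : ι → (Fin 2 → Fin 3) → ℂ}
    (hα : LinearIndependent ℂ α) (lam mu xh yh : ι → Fin 3 → ℂ)
    (hprod : ∀ i, α i = fun f => lam i (f 0) * mu i (f 1))
    (hx0 : ∀ i, xh i ≠ 0) (hx : ∀ i, contract3 D (lam i) *ᵥ xh i = 0)
    (hy0 : ∀ i, yh i ≠ 0) (hy : ∀ i, contract3 D (mu i) *ᵥ yh i = 0)
    (K : Submodule ℂ ((Fin 2 → Fin 3) → ℂ)) (hK : 2 ≤ Module.finrank ℂ K)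
    (hKI : ∀ i, K ≤ LinearMap.range (contract3 (kroneckerPow D 2) (α i)).mulVecLin) : False := by
  obtain ⟨i₀⟩ : Nonempty ι := Fintype.card_pos_iff.mp (by omega)
  have hlam0 : ∀ i, lam i ≠ 0 := fun i h => hα.ne_zero i (by rw [hprod i]; funext f; simp [h])
  have hmu0 : ∀ i, mu i ≠ 0 := fun i h => hα.ne_zero i (by rw [hprod i]; funext f; simp [h])
  have hann : ∀ i, ∀ x ∈ K,
      (∀ c', ∑ b, xh i b * x ![b, c'] = 0) ∧ (∀ b', ∑ c, x ![b', c] * yh i c = 0) := by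
    intro i x hxK
    obtain ⟨v, hv⟩ := LinearMap.mem_range.mp (hKI i hxK)
    rw [← hv, Matrix.mulVecLin_apply, hprod i]
    exact ⟨fun c' => left_vanish hD _ _ _ (hx i) v c', fun b' => right_vanish hD _ _ _ (hy i) v b'⟩
  by_cases hX : ∃ a b, LinearIndependent ℂ ![xh a, xh b]
  · by_cases hY : ∃ c d, LinearIndependent ℂ ![yh c, yh d]
    · obtain ⟨a, b, hab⟩ := hX
      obtain ⟨c, d, hcd⟩ := hY
      have h1 := finrank_le_one_of_vanishing hab hcd K fun x hxK =>
        ⟨(hann a x hxK).1, (hann b x hxK).1, (hann c x hxK).2, (hann d x hxK).2⟩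
      omega
    · push Not at hY
      -- all `μ_i` are proportional to `μ_{i₀}` (rigidity)
      have hmu : ∀ i, ∃ d : ℂ, mu i = d • mu i₀ := by
        intro i
        obtain ⟨c, hc⟩ := exists_smul_of_not_pair (hy0 i₀) (hY i₀ i)
        have hc0 : c ≠ 0 := by
          rintro rfl
          exact hy0 i (by rw [hc, zero_smul])
        have h1 : contract3 D (mu i) *ᵥ yh i₀ = 0 := by
          have h := hy i
          rw [hc, Matrix.mulVec_smul] at h
          exact (smul_eq_zero.mp h).resolve_left hc0
        exact exists_smul_of_common_kernel hD (hy0 i₀) (hmu0 i₀) (hy i₀) h1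
      let Ψ : (Fin 3 → ℂ) →ₗ[ℂ] ((Fin 2 → Fin 3) → ℂ) :=
        { toFun := fun m f => m (f 0) * mu i₀ (f 1)
          map_add' := fun m m' => by funext f; simp [add_mul]
          map_smul' := fun c m => by funext f; simp [mul_assoc] }
      have hmem : ∀ i, α i ∈ LinearMap.range Ψ := by
        intro i
        obtain ⟨d, hd⟩ := hmu i
        refine ⟨d • lam i, ?_⟩
        rw [hprod i, hd]
        funext f
        simp [Ψ]
        ring
      have := card_le_finrank_of_mem_range hα Ψ hmem
      simp only [Module.finrank_fintype_fun_eq_card, Fintype.card_fin] at this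
      omega
  · push Not at hX
    -- all `λ_i` are proportional to `λ_{i₀}` (rigidity)
    have hlam : ∀ i, ∃ d : ℂ, lam i = d • lam i₀ := by
      intro i
      obtain ⟨c, hc⟩ := exists_smul_of_not_pair (hx0 i₀) (hX i₀ i)
      have hc0 : c ≠ 0 := by
        rintro rfl
        exact hx0 i (by rw [hc, zero_smul])
      have h1 : contract3 D (lam i) *ᵥ xh i₀ = 0 := by
        have h := hx i
        rw [hc, Matrix.mulVec_smul] at h
        exact (smul_eq_zero.mp h).resolve_left hc0
      exact exists_smul_of_common_kernel hD (hx0 i₀) (hlam0 i₀) (hx i₀) h1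
    let Ψ : (Fin 3 → ℂ) →ₗ[ℂ] ((Fin 2 → Fin 3) → ℂ) :=
      { toFun := fun m f => lam i₀ (f 0) * m (f 1)
        map_add' := fun m m' => by funext f; simp [mul_add]
        map_smul' := fun c m => by funext f; simp [mul_left_comm] }
    have hmem : ∀ i, α i ∈ LinearMap.range Ψ := by
      intro i
      obtain ⟨d, hd⟩ := hlam i
      refine ⟨d • mu i, ?_⟩
      rw [hprod i, hd]
      funext f
      simp [Ψ]
      ring
    have := card_le_finrank_of_mem_range hα Ψ hmem
    simp only [Module.finrank_fintype_fun_eq_card, Fintype.card_fin] at this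
    omega

/-! ## §2  `⟨7⟩ ≰ D^{⊠2}`, `⟨7⟩ ≰ cw₂^{⊠2}`, `Q(cw₂^{⊠2}) ≤ 6` -/

/-- **`⟨7⟩ ≰ D^{⊠2}`** — the Kronecker square of the (diagonalised) Coppersmith–Winograd tensor
`cw₂` does not restrict to the unit tensor `⟨7⟩`.  A restriction is `B T₂(α_i) Cᵀ = E_{ii}`
(`i < 7`, `A, B, C` of row rank `7` in `ℂ⁹`); Sylvester's inequality gives `rank T₂(α_i) ≤ 5`, the
slice gap makes every `α_i` a product with singular factors, the kernel dichotomy puts the plane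
`ker B` or `ker C` inside `col T₂(α_i)` for at least four `i`, and four product slices cannot share a
kernel plane. [cite: ChristandlVranaZuiddam2023, §1.1] -/
theorem not_unitTensor_seven_le_diagPow_two
    (hD : ∀ a b c, D a b c = if a ≠ b ∧ b ≠ c ∧ a ≠ c then 1 else 0) :
    ¬ TensorRestrictsTo (kroneckerPow D 2) (unitTensor ℂ 7) := by
  rintro ⟨A, B, C, hs⟩
  have hA : LinearIndependent ℂ A := linearIndependent_fst hs
  have hB : LinearIndependent ℂ B := linearIndependent_snd hs
  have hC : LinearIndependent ℂ C := linearIndependent_trd hs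
  have hsand := sandwich_eq hs
  have h9 : Fintype.card (Fin 2 → Fin 3) = 9 := by simp
  have hrB : (Matrix.of B).rank = 7 := by
    rw [Matrix.rank_eq_finrank_span_row, show (Matrix.of B).row = B from rfl,
      finrank_span_eq_card hB, Fintype.card_fin]
  have hrC : (Matrix.of C).rank = 7 := by
    rw [Matrix.rank_eq_finrank_span_row, show (Matrix.of C).row = C from rfl,
      finrank_span_eq_card hC, Fintype.card_fin]
  -- Sylvester: `rank T₂(α_i) ≤ 5`; minrank: `rank T₂(α_i) ≥ 4`
  have hT5 : ∀ i, (contract3 (kroneckerPow D 2) (A i)).rank ≤ 5 := by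
    intro i
    have h1 := Literature.LinearAlgebra.Matrix.rank_add_rank_le_rank_mul_add_card (Matrix.of B)
      (contract3 (kroneckerPow D 2) (A i))
    have h2 := Literature.LinearAlgebra.Matrix.rank_add_rank_le_rank_mul_add_card
      (Matrix.of B * contract3 (kroneckerPow D 2) (A i)) (Matrix.of C)ᵀ
    have h3 : (Matrix.of B * contract3 (kroneckerPow D 2) (A i) * (Matrix.of C)ᵀ).rank ≤ 1 := by
      rw [hsand i]
      exact rank_of_unitTensor_le 7 i
    rw [Matrix.rank_transpose, hrC, h9] at h2
    rw [hrB, h9] at h1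
    omega
  have hT4 : ∀ i, 4 ≤ (contract3 (kroneckerPow D 2) (A i)).rank := fun i => by
    have := two_pow_le_rank_slice hD 2 (hA.ne_zero i)
    simpa using this
  -- the slice gap: every slice is a product with singular factors
  choose lam mu xh yh hprod hx0 hx hy0 hy using
    fun i => exists_prod_two hD (A i) (hA.ne_zero i) (hT5 i)
  -- the two kernels are planes in `ℂ⁹`
  have hkB : Module.finrank ℂ (LinearMap.ker (Matrix.of B).mulVecLin) = 2 := by
    have h := LinearMap.finrank_range_add_finrank_ker (Matrix.of B).mulVecLin
    rw [Module.finrank_fintype_fun_eq_card, h9] at h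
    change (Matrix.of B).rank + _ = 9 at h
    omega
  have hkC : Module.finrank ℂ (LinearMap.ker (Matrix.of C).mulVecLin) = 2 := by
    have h := LinearMap.finrank_range_add_finrank_ker (Matrix.of C).mulVecLin
    rw [Module.finrank_fintype_fun_eq_card, h9] at h
    change (Matrix.of C).rank + _ = 9 at h
    omega
  -- the kernel dichotomy, slice by slice
  have hdich : ∀ i, LinearMap.ker (Matrix.of B).mulVecLin ≤
      LinearMap.range (contract3 (kroneckerPow D 2) (A i)).mulVecLin ∨
      LinearMap.ker (Matrix.of C).mulVecLin ≤
      LinearMap.range (contract3 (kroneckerPow D 2) (A i)).mulVecLin := by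
    intro i
    refine ker_le_range_or B C _ (slice_transpose hD 2 (A i)) i (fun j l hjl => ?_) hB hC
      (by rw [h9]; have := hT4 i; omega)
    rw [hsand i, Matrix.of_apply, unitTensor_apply]
    exact if_neg fun h => hjl ⟨h.1.symm, (h.1.trans h.2).symm⟩
  -- pigeonhole: one kernel plane serves at least four slices
  classical
  let SB : Finset (Fin 7) := Finset.univ.filter fun i => LinearMap.ker (Matrix.of B).mulVecLin ≤
    LinearMap.range (contract3 (kroneckerPow D 2) (A i)).mulVecLin
  let SC : Finset (Fin 7) := Finset.univ.filter fun i => LinearMap.ker (Matrix.of C).mulVecLin ≤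
    LinearMap.range (contract3 (kroneckerPow D 2) (A i)).mulVecLin
  have hunion : SB ∪ SC = Finset.univ := by
    ext i
    simp only [SB, SC, Finset.mem_union, Finset.mem_filter, Finset.mem_univ, true_and, iff_true]
    exact hdich i
  have hcard : 7 ≤ SB.card + SC.card := by
    have := Finset.card_union_le SB SC
    rw [hunion, Finset.card_univ, Fintype.card_fin] at this
    exact this
  by_cases hSB : 4 ≤ SB.card
  · exact false_of_ker_le_range hD (ι := ↥SB) (by simpa using hSB)
      (hα := hA.comp Subtype.val Subtype.val_injective)
      (fun i => lam i) (fun i => mu i) (fun i => xh i) (fun i => yh i)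
      (fun i => hprod i) (fun i => hx0 i) (fun i => hx i) (fun i => hy0 i) (fun i => hy i)
      (LinearMap.ker (Matrix.of B).mulVecLin) (by rw [hkB])
      (fun i => (Finset.mem_filter.mp i.2).2)
  · have hSC : 4 ≤ SC.card := by omega
    exact false_of_ker_le_range hD (ι := ↥SC) (by simpa using hSC)
      (hα := hA.comp Subtype.val Subtype.val_injective)
      (fun i => lam i) (fun i => mu i) (fun i => xh i) (fun i => yh i)
      (fun i => hprod i) (fun i => hx0 i) (fun i => hx i) (fun i => hy0 i) (fun i => hy i)
      (LinearMap.ker (Matrix.of C).mulVecLin) (by rw [hkC])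
      (fun i => (Finset.mem_filter.mp i.2).2)

/-- **`D^{⊠2} ≥ cw₂^{⊠2}`**: over `ℂ`, `cw₂ = (M, M, M) · D` with
`M = [[1/2, 0, 0], [0, 1, 1], [0, i, -i]]` (`3 x₀ (x₁² + x₂²) = 6 (x₀/2)(x₁ + i x₂)(x₁ - i x₂)` as cubic
forms), squared. [cite: LandsbergGCT2017, §3.4.9] -/
theorem diagPow_two_restrictsTo_cwPow_two
    (hD : ∀ a b c, D a b c = if a ≠ b ∧ b ≠ c ∧ a ≠ c then 1 else 0) :
    TensorRestrictsTo (kroneckerPow D 2) (kroneckerPow (cwTensor ℂ 2) 2) := by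
  have base : TensorRestrictsTo D (cwTensor ℂ 2) := by
    refine ⟨!![(1/2 : ℂ), 0, 0; 0, 1, 1; 0, Complex.I, -Complex.I],
      !![(1/2 : ℂ), 0, 0; 0, 1, 1; 0, Complex.I, -Complex.I],
      !![(1/2 : ℂ), 0, 0; 0, 1, 1; 0, Complex.I, -Complex.I], fun a' b' c' => ?_⟩
    rw [cwTensor_apply]
    simp only [Fin.sum_univ_three, hD]
    fin_cases a' <;> fin_cases b' <;> fin_cases c' <;> simp <;> ring_nf <;> simp [Complex.I_sq]
  exact base.kroneckerPow 2

/-- **`⟨7⟩ ≰ cw₂^{⊠2}`** — the unit tensor `⟨7⟩` is not a restriction of the Kronecker square of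
the Coppersmith–Winograd tensor `T_{cw,2}`. [cite: ChristandlVranaZuiddam2023, §1.1] -/
theorem not_unitTensor_seven_le_cwPow_two :
    ¬ TensorRestrictsTo (kroneckerPow (cwTensor ℂ 2) 2) (unitTensor ℂ 7) := by
  intro h
  let D' : Fin 3 → Fin 3 → Fin 3 → ℂ := fun a b c => if a ≠ b ∧ b ≠ c ∧ a ≠ c then 1 else 0
  have hD' : ∀ a b c, D' a b c = if a ≠ b ∧ b ≠ c ∧ a ≠ c then 1 else 0 := fun _ _ _ => rfl
  exact not_unitTensor_seven_le_diagPow_two hD' ((diagPow_two_restrictsTo_cwPow_two hD').trans h)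

/-- **`Q(cw₂^{⊠2}) ≤ 6`**: the subrank of the Kronecker square of `T_{cw,2}` is at most `6`
(with the tree's zeroing-out floor `⟨6⟩ ≤ cw₂^{⊠2}` this is `Q(cw₂^{⊠2}) = 6`: the `N = 2` packing
window `6 ≤ Q ≤ 7` closes at its floor). [cite: ChristandlVranaZuiddam2023, §1.1] -/
theorem subrank_cwPow_two_le_six : subrank ℂ (kroneckerPow (cwTensor ℂ 2) 2) ≤ 6 := by
  by_contra h
  push Not at h
  exact not_unitTensor_seven_le_cwPow_two
    ((Literature.Barriers.MatrixMultiplication.restrictsTo_unitTensor_iff_le_subrank _ 7).mpr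
      (by omega))

end Summit.MatrixMultiplication.MatrixMultiplication.Theorems.OutsiderSandwichSubrankSix
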